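import Summits.MatrixMultiplication.OmegaCensus.ThreeSetLineInverseCertificateFast
import HarnessLib

/-!
# Packed correlation of count vectors: one bignum product, read through base-`X` digits

ω-census `pub-omega`, family (b3), seat pub-omega-group gen 40.  Framing: lottery ticket; floor = certified bounds/negative
ranges.  VALUE: the arithmetic core of the packed dual-certificate kit `ThreeSetLineFarkasFast` for the three-set cube cells
over `A ↠ ℤ_p²`; a kernel TOOL, NOT progress on ω.

* `lconv a b` — the linear convolution of two lists; **`enc_lconv`**: `enc X (lconv a b) = enc X a · enc X b` (packing
  multiplies); `lconv_getD`: `(lconv a b)(n) = Σ_{r<n+1} a(r)·b(n−r)`; `lconv_getD_le`: entries `≤ Σa · Σb`.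
* `gammaL q X z a` — the **packed correlation** `Γ(z, a)(u) = Σ_{r<q} z(r)·a((r + q − u) mod q)` (`u < q`), computed as
  digit `q − 1 + u` plus digit `u − 1` of the single product `enc X z · enc X (reverse a)`; **`gammaL_getD`** proves it for
  lists of length `q` when `Σz · Σa < X` (no carries; `digit_enc` of `ThreeSetLineInverseCertificateFast`).
* `sum_range_mod_shift`: `Σ_{v<q} f((v + t) mod q) = Σ_{r<q} f(r)`.
-/

namespace Summit.MatrixMultiplication.OmegaCensus

open Finset

namespace LineInv

/-! ## Linear convolution of lists and its packing -/

/-- Pointwise sum of two lists, padding the shorter with zeros. [folklore] -/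
def ladd : List ℕ → List ℕ → List ℕ
  | [], v => v
  | x :: u, [] => x :: u
  | x :: u, y :: v => (x + y) :: ladd u v

/-- Linear (acyclic) convolution: `(lconv a b)(n) = Σ_{r ≤ n} a(r)·b(n − r)`. [folklore] -/
def lconv : List ℕ → List ℕ → List ℕ
  | [], _ => []
  | a :: as, b => ladd (b.map fun y => a * y) (0 :: lconv as b)

/-- `enc` is additive on `ladd`. [folklore] -/
theorem enc_ladd (X : ℕ) : ∀ u v : List ℕ, enc X (ladd u v) = enc X u + enc X v
  | [], v => by simp [ladd, enc]
  | x :: u, [] => by simp [ladd, enc]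
  | x :: u, y :: v => by simp only [ladd, enc]; rw [enc_ladd X u v]; ring

/-- `enc` is homogeneous. [folklore] -/
theorem enc_map_mul (X a : ℕ) : ∀ b : List ℕ, enc X (b.map fun y => a * y) = a * enc X b
  | [] => by simp [enc]
  | y :: b => by simp only [List.map_cons, enc]; rw [enc_map_mul X a b]; ring

/-- **Packing multiplies**: `enc (lconv a b) = enc a · enc b`. [folklore] -/
theorem enc_lconv (X : ℕ) : ∀ a b : List ℕ, enc X (lconv a b) = enc X a * enc X b
  | [], b => by simp [lconv, enc]
  | x :: a, b => by
    simp only [lconv, enc]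
    rw [enc_ladd, enc_map_mul, enc, enc_lconv X a b]
    ring

/-- Entries of a scaled list. [folklore] -/
theorem getD_map_mul (x : ℕ) (b : List ℕ) (n : ℕ) : (b.map fun y => x * y).getD n 0 = x * b.getD n 0 := by
  rw [List.getD_eq_getElem?_getD, List.getElem?_map, List.getD_eq_getElem?_getD]
  cases b[n]? <;> simp

/-- Reading a reversed list of length `q`. [folklore] -/
theorem getD_reverse_of_length {F : List ℕ} {q : ℕ} (hF : F.length = q) (j : ℕ) (hj : j < q) :
    F.reverse.getD j 0 = F.getD (q - 1 - j) 0 := by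
  rw [List.getD_eq_getElem?_getD, List.getElem?_reverse (by rw [hF]; exact hj), hF, ← List.getD_eq_getElem?_getD]

/-- Entries of `ladd`. [folklore] -/
theorem ladd_getD : ∀ (u v : List ℕ) (n : ℕ), (ladd u v).getD n 0 = u.getD n 0 + v.getD n 0
  | [], v, n => by simp [ladd]
  | x :: u, [], n => by simp [ladd]
  | x :: u, y :: v, 0 => by simp [ladd]
  | x :: u, y :: v, n + 1 => by simp only [ladd, List.getD_cons_succ]; exact ladd_getD u v n

/-- **Entries of the linear convolution**: `(lconv a b)(n) = Σ_{r<n+1} a(r)·b(n−r)`. [folklore] -/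
theorem lconv_getD : ∀ (a b : List ℕ) (n : ℕ),
    (lconv a b).getD n 0 = ∑ r ∈ Finset.range (n + 1), a.getD r 0 * b.getD (n - r) 0
  | [], b, n => by simp [lconv]
  | x :: a, b, 0 => by
    show (ladd (b.map fun y => x * y) (0 :: lconv a b)).getD 0 0 = _
    rw [ladd_getD, getD_map_mul, List.getD_cons_zero, Finset.sum_range_one, List.getD_cons_zero, Nat.sub_zero, add_zero]
  | x :: a, b, n + 1 => by
    show (ladd (b.map fun y => x * y) (0 :: lconv a b)).getD (n + 1) 0 = _
    rw [ladd_getD, getD_map_mul, List.getD_cons_succ, lconv_getD a b n, Finset.sum_range_succ' _ (n + 1)]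
    simp only [List.getD_cons_succ, List.getD_cons_zero, Nat.sub_zero, Nat.succ_sub_succ]
    ring

/-- Entries of the linear convolution are bounded by `Σa · Σb`. [folklore] -/
theorem lconv_getD_le : ∀ (a b : List ℕ) (n : ℕ), (lconv a b).getD n 0 ≤ a.sum * b.sum
  | [], b, n => by simp [lconv]
  | x :: a, b, n => by
    show (ladd (b.map fun y => x * y) (0 :: lconv a b)).getD n 0 ≤ _
    rw [List.sum_cons, ladd_getD, add_mul, getD_map_mul]
    refine Nat.add_le_add (Nat.mul_le_mul_left x (getD_le_sum b n)) ?_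
    · cases n with
      | zero => simp
      | succ n => rw [List.getD_cons_succ]; exact lconv_getD_le a b n

/-! ## The packed correlation `Γ` -/

/-- **Packed correlation** `Γ(z, a)(u) = Σ_{r<q} z(r)·a((r + q − u) mod q)`, `u < q`, read from the digits of the single product
`enc z · enc (reverse a)` (digit `q − 1 + u`, plus digit `u − 1` for the wrapped terms). [folklore] -/
def gammaL (q X : ℕ) (z a : List ℕ) : List ℕ :=
  let P := enc X z * enc X a.reverse
  (List.range q).map fun u => digit X P (q - 1 + u) + (if u = 0 then 0 else digit X P (u - 1))

/-- A modular re-indexing of a sum over `range q`: `Σ_{v<q} f((v + t) mod q) = Σ_{r<q} f(r)`. [folklore] -/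
theorem sum_range_mod_shift (q t : ℕ) (hq : 0 < q) (f : ℕ → ℕ) :
    ∑ v ∈ Finset.range q, f ((v + t) % q) = ∑ r ∈ Finset.range q, f r := by
  haveI : NeZero q := ⟨hq.ne'⟩
  rw [← sum_zmod_val (fun i => f ((i + t) % q)), ← sum_zmod_val f]
  have e : ∀ v : ZMod q, (v + (t : ZMod q)).val = (v.val + t) % q := fun v => by
    rw [ZMod.val_add, ZMod.val_natCast, Nat.add_mod, Nat.mod_mod, ← Nat.add_mod]
  rw [Finset.sum_congr rfl fun (v : ZMod q) _ => (congrArg f (e v)).symm]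
  exact Fintype.sum_equiv (Equiv.addRight (t : ZMod q)) _ _ fun v => rfl

/-- **Correctness of the packed correlation** (no carries when `Σz · Σa < X`). [folklore] -/
theorem gammaL_getD {q X : ℕ} {z a : List ℕ} (hX : 0 < X) (hz : z.length = q) (ha : a.length = q)
    (hb : z.sum * a.sum < X) (u : ℕ) (hu : u < q) :
    (gammaL q X z a).getD u 0 = ∑ r ∈ Finset.range q, z.getD r 0 * a.getD ((r + q - u) % q) 0 := by
  unfold gammaL
  rw [getD_range_map _ hu, ← enc_lconv]
  have hdig : ∀ n, digit X (enc X (lconv z a.reverse)) n = (lconv z a.reverse).getD n 0 := fun n =>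
    digit_enc hX _ n fun x hx => by
      obtain ⟨i, hi, rfl⟩ := List.getElem_of_mem hx
      have h0 := lconv_getD_le z a.reverse i
      rw [List.getD_eq_getElem _ _ hi, List.sum_reverse] at h0
      exact lt_of_le_of_lt h0 hb
  -- reading the reversed list
  have hrev : ∀ j, a.reverse.getD j 0 = if j < q then a.getD (q - 1 - j) 0 else 0 := by
    intro j
    by_cases hj : j < q
    · rw [if_pos hj, getD_reverse_of_length ha j hj]
    · rw [if_neg hj, List.getD_eq_getElem?_getD, List.getElem?_eq_none_iff.2 (by rw [List.length_reverse, ha]; omega)]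
      rfl
  have hzq : ∀ r, q ≤ r → z.getD r 0 = 0 := fun r hr => by
    rw [List.getD_eq_getElem?_getD, List.getElem?_eq_none_iff.2 (by rw [hz]; exact hr)]; rfl
  rw [hdig, lconv_getD]
  -- main digit: terms `u ≤ r < q` carry `a(r - u)`, the rest vanish
  have hmain : ∑ r ∈ Finset.range (q - 1 + u + 1), z.getD r 0 * a.reverse.getD (q - 1 + u - r) 0 =
      ∑ r ∈ Finset.range q, if u ≤ r then z.getD r 0 * a.getD (r - u) 0 else 0 := by
    rw [← Finset.sum_range_add_sum_Ico _ (show q ≤ q - 1 + u + 1 by omega)]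
    have hz0 : ∑ r ∈ Finset.Ico q (q - 1 + u + 1), z.getD r 0 * a.reverse.getD (q - 1 + u - r) 0 = 0 :=
      Finset.sum_eq_zero fun r hr => by rw [hzq r (Finset.mem_Ico.1 hr).1, zero_mul]
    rw [hz0, add_zero]
    refine Finset.sum_congr rfl fun r hr => ?_
    rw [Finset.mem_range] at hr
    rw [hrev]
    by_cases hur : u ≤ r
    · rw [if_pos (by omega), if_pos hur]; congr 2; omega
    · rw [if_neg (by omega), if_neg hur, mul_zero]
  rw [hmain]
  by_cases hu0 : u = 0
  · subst hu0
    rw [if_pos rfl, add_zero]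
    refine Finset.sum_congr rfl fun r hr => ?_
    rw [Finset.mem_range] at hr
    rw [if_pos (Nat.zero_le r), Nat.sub_zero, Nat.sub_zero, Nat.add_mod_right, Nat.mod_eq_of_lt hr]
  · rw [if_neg hu0, hdig, lconv_getD]
    -- wrapped digit: terms `r < u` carry `a(r + q - u)`
    have hwrap : ∑ r ∈ Finset.range (u - 1 + 1), z.getD r 0 * a.reverse.getD (u - 1 - r) 0 =
        ∑ r ∈ Finset.range q, if u ≤ r then 0 else z.getD r 0 * a.getD (r + q - u) 0 := by
      rw [show u - 1 + 1 = u by omega, ← Finset.sum_range_add_sum_Ico _ hu.le]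
      have h0 : ∑ r ∈ Finset.Ico u q, (if u ≤ r then 0 else z.getD r 0 * a.getD (r + q - u) 0) = 0 :=
        Finset.sum_eq_zero fun r hr => by rw [if_pos (Finset.mem_Ico.1 hr).1]
      rw [h0, add_zero]
      refine Finset.sum_congr rfl fun r hr => ?_
      rw [Finset.mem_range] at hr
      rw [if_neg (by omega), hrev, if_pos (by omega)]
      congr 2; omega
    rw [hwrap, ← Finset.sum_add_distrib]
    refine Finset.sum_congr rfl fun r hr => ?_
    rw [Finset.mem_range] at hr
    by_cases hur : u ≤ r
    · rw [if_pos hur, if_pos hur, add_zero, show r + q - u = (r - u) + q by omega, Nat.add_mod_right,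
        Nat.mod_eq_of_lt (by omega : r - u < q)]
    · rw [if_neg hur, if_neg hur, zero_add, Nat.mod_eq_of_lt (by omega : r + q - u < q)]

end LineInv

end Summit.MatrixMultiplication.OmegaCensus
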